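import Mathlib
import Summits.KontsevichZagierPeriods.Zeta5Search.BrickBonusWeights
import Summits.KontsevichZagierPeriods.Zeta5Search.BrickLevelReductionInf
import Summits.KontsevichZagierPeriods.Zeta5Search.BrickPropositionHInf
import Summits.KontsevichZagierPeriods.Zeta5Search.BrickDenominators

/-!
# BrickBonusReduction — the one-level reduction of `BrickLevelReductionInf` WITH THE CARRY BONUS: in the regime
`{n/p} ≥ 2/3` the reduction error is `≤ exp(−(L+B))` (cell zeta5-irr)

HONEST FRAMING: systematic search; no irrationality claim unless certified. INSTRUMENT lemmas of the ζ(5)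
census cell zeta5-irr (HOME `run/shared/lean/pub/zeta5-irr/`), filed by the engine seat zi-eng (g12); sequel of
`BrickBonusResidueLaw`, `BrickBonusWeights`; used by `BrickBonusStep` (Krattenthaler–Rivoal's Théorèmes 4–5 at odd
primes). Nothing here is about ζ(5); no irrationality content; 0 nats/n; rung F-Z1 NOT moved.

## Statements (`p` odd, `2B ≤ A`, `1 ≤ B`, `ε ≤ 1`, row `n = n₀ + Np`, `n₀ < p`, `N < p^{L+1}`, **`3n₀ ≥ 2p`**)

* `residueLaw_circ_zero_bonus`: the harmonic ° residue law with the bonus kept,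
  `v(p^{(L+1)A}cell^{(0)}_j(n) − λ_j·p^{LA}cell̃^{(0)}_J(N)) ≤ exp(−(L + m))`, `m = B c_a + B c_b + ε c_c`.
* **`level_reduction_bonus`**, **`level_reduction_bonus_zero`**:
  `v(Σ_{k≤n} g(k)r_k^{(s)}(n) − Σ_{K≤N} W(K)r̃_K^{(s)}(N) − Σ_{K<N} G(K)r̃_K^{(s)}(N−1)) ≤ exp(−(L+B))` for every
  `g ∈ ℤ_(p)` (° cells: `BrickBonusResidueLaw.residueLaw_circ_depth_bonus` with `m ≥ B` by `carries_pos`; the exact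
  centre: `BrickBonusWeights.centre_cell_bonus`; hole cells: `exp(−(A+L))`, `A ≥ B`) — versus `exp(−(L+1))` in
  `BrickLevelReductionInf.level_reduction_inf`.
-/

namespace Summit.KontsevichZagierPeriods.Zeta5Search.BrickBonusReduction

open Finset Nat Polynomial WithZero
open Summit.KontsevichZagierPeriods.Zeta5Search.BrickTopCoefficient (cTop)
open Summit.KontsevichZagierPeriods.Zeta5Search.BrickLaurent (laurent cell laurent_zero)
open Summit.KontsevichZagierPeriods.Zeta5Search.BrickPartialFractions (cellZero xCoeff xZero)
open Summit.KontsevichZagierPeriods.Zeta5Search.BrickLambda (cTop_zero_ne_zero le_one_of_cong)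
open Summit.KontsevichZagierPeriods.Zeta5Search.BrickHarmonicBlocks (hsum)
open Summit.KontsevichZagierPeriods.Zeta5Search.BrickDigitStepDZero (cellZero_eq)
open Summit.KontsevichZagierPeriods.Zeta5Search.BrickResidueLawMain (cong_mul_le level_hsum_sub_le
  level_laurent_integral level_hsum_integral)
open Summit.KontsevichZagierPeriods.Zeta5Search.BrickDigitStripCirc (centreCarry)
open Summit.KontsevichZagierPeriods.Zeta5Search.BrickResidueLawCirc (lambda_circ lambda_circ_le_one)
open Summit.KontsevichZagierPeriods.Zeta5Search.BrickLevelReduction (blockWeight cTop_one_centre sum_range_digit_split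
  row_lt)
open Summit.KontsevichZagierPeriods.Zeta5Search.BrickHoleWeight (holeWeight holeWeight_le holeWeight_reflect_add_le
  holeWeight_local)
open Summit.KontsevichZagierPeriods.Zeta5Search.BrickLevelReductionInf (hole_cell_le hole_cellZero_le)
open Summit.KontsevichZagierPeriods.Zeta5Search.BrickPropositionH (padicValuation_div_prime_le)
open Summit.KontsevichZagierPeriods.Zeta5Search.BrickPropositionHInf (padicValuation_div_pow_le propositionH_inf)
open Summit.KontsevichZagierPeriods.Zeta5Search.BrickBonusResidueLaw (residueLaw_circ_depth_bonus)
open Summit.KontsevichZagierPeriods.Zeta5Search.BrickBonusWeights (carryCount_ge blockWeight_bonus_le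
  blockWeight_bonus_reflect blockWeight_bonus_local centre_cell_bonus centre_cellZero_bonus)
open Summit.KontsevichZagierPeriods.Zeta5Search.BrickDenominators (le_exp_of_pow_mul_le padicValuation_lcmUpto)

noncomputable section

variable {p : ℕ} [Fact p.Prime]

/-! ## The harmonic ° residue law with the bonus -/

section circzero

variable (hp2 : p ≠ 2) {A B ε N n₀ J j₀ n j L : ℕ} (hAB : 2 * B ≤ A) (hn : n = n₀ + N * p) (hj : j = j₀ + J * p)
  (hN : N < p ^ (L + 1)) (hn₀ : n₀ < p) (hj₀ : j₀ ≤ n₀) (hJN : J ≤ N) (hcen : 2 * j ≠ n ∨ ε = 0)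
include hp2 hAB hn hj hN hn₀ hj₀ hJN hcen

/-- **The harmonic ° residue law with the carry bonus kept**: `v(p^{(L+1)A}cell^{(0)}_j(n) − λ·p^{LA}cell̃^{(0)}_J(N)) ≤
exp(−(L + m))`, `m = B c_a + B c_b + ε c_c` (`BrickResidueLawCirc.residueLaw_circ_zero`: `exp(−(L+1))`). -/
theorem residueLaw_circ_zero_bonus {lam : ℚ} (hmul : lam * cTop A B 0 N J = cTop A B ε n j) :
    Rat.padicValuation p ((p : ℚ) ^ ((L + 1) * A) * cellZero A B ε n j -
      lam * ((p : ℚ) ^ (L * A) * cellZero A B 0 N J)) ≤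
      exp (-((L : ℤ) + (B * ((n₀ + j₀) / p) + B * ((n₀ + (n₀ - j₀)) / p) + ε * centreCarry p n j : ℕ))) := by
  have hp : p.Prime := Fact.out
  set m : ℕ := B * ((n₀ + j₀) / p) + B * ((n₀ + (n₀ - j₀)) / p) + ε * centreCarry p n j with hm
  have hJ : j / p = J := by rw [hj, Nat.add_mul_div_right _ _ hp.pos, Nat.div_eq_of_lt (by omega), zero_add]
  have hJlt : J < p ^ (L + 1) := lt_of_le_of_lt hJN hN
  have hlam := lambda_circ hp2 hn hj hn₀ hj₀ hJN hmul
  have hx : (p : ℚ) ^ ((L + 1) * A) * cellZero A B ε n j =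
      -∑ s ∈ Icc 1 A, ((p : ℚ) ^ ((L + 1) * (A - s)) * cell A B ε n j s) * ((p : ℚ) ^ ((L + 1) * s) * hsum s j) := by
    rw [cellZero_eq, mul_neg, Finset.mul_sum]
    congr 1
    refine Finset.sum_congr rfl fun s hs => ?_
    have hs' := mem_Icc.1 hs
    rw [show (p : ℚ) ^ ((L + 1) * A) = (p : ℚ) ^ ((L + 1) * (A - s)) * (p : ℚ) ^ ((L + 1) * s) by
      rw [← pow_add, ← mul_add, Nat.sub_add_cancel hs'.2]]
    ring
  have hy : lam * ((p : ℚ) ^ (L * A) * cellZero A B 0 N J) =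
      -∑ s ∈ Icc 1 A, (lam * ((p : ℚ) ^ (L * (A - s)) * cell A B 0 N J s)) * ((p : ℚ) ^ (L * s) * hsum s J) := by
    rw [cellZero_eq, mul_neg, mul_neg, Finset.mul_sum, Finset.mul_sum]
    congr 1
    refine Finset.sum_congr rfl fun s hs => ?_
    have hs' := mem_Icc.1 hs
    rw [show (p : ℚ) ^ (L * A) = (p : ℚ) ^ (L * (A - s)) * (p : ℚ) ^ (L * s) by
      rw [← pow_add, ← mul_add, Nat.sub_add_cancel hs'.2]]
    ring
  rw [hx, hy, neg_sub_neg, ← Finset.sum_sub_distrib]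
  refine Valuation.map_sum_le _ fun s hs => ?_
  have hs' := mem_Icc.1 hs
  rw [Valuation.map_sub_swap]
  have hlaw := residueLaw_circ_depth_bonus hp2 hAB hn hj hN hn₀ hj₀ hJN hcen hmul (A - s)
  have hH := level_hsum_sub_le (p := p) hs'.1 L j
  rw [hJ] at hH
  -- `x₁ = p^{(L+1)(A−s)}c`, `y₁ = λ·p^{L(A−s)}c̃`, `x₂, y₂` the harmonic sums
  have hy₁ : Rat.padicValuation p (lam * ((p : ℚ) ^ (L * (A - s)) * cell A B 0 N J s)) ≤ exp (-(m : ℤ)) := by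
    rw [map_mul]
    calc _ ≤ exp (-(m : ℤ)) * 1 := mul_le_mul' hlam (level_laurent_integral hp2 hAB hN hJN (A - s))
      _ = _ := mul_one _
  have hx₁ : Rat.padicValuation p ((p : ℚ) ^ ((L + 1) * (A - s)) * cell A B ε n j s) ≤ exp (-(m : ℤ)) := by
    have h' : Rat.padicValuation p (((p : ℚ) ^ ((L + 1) * (A - s)) * cell A B ε n j s -
        lam * ((p : ℚ) ^ (L * (A - s)) * cell A B 0 N J s)) +
        lam * ((p : ℚ) ^ (L * (A - s)) * cell A B 0 N J s)) ≤ exp (-(m : ℤ)) :=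
      Valuation.map_add_le _ (hlaw.trans (exp_le_exp.2 (by linarith [Int.natCast_nonneg L]))) hy₁
    rwa [sub_add_cancel] at h'
  rw [show (p : ℚ) ^ ((L + 1) * (A - s)) * cell A B ε n j s * ((p : ℚ) ^ ((L + 1) * s) * hsum s j) -
      lam * ((p : ℚ) ^ (L * (A - s)) * cell A B 0 N J s) * ((p : ℚ) ^ (L * s) * hsum s J) =
    ((p : ℚ) ^ ((L + 1) * (A - s)) * cell A B ε n j s) *
        ((p : ℚ) ^ ((L + 1) * s) * hsum s j - (p : ℚ) ^ (L * s) * hsum s J) +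
      ((p : ℚ) ^ ((L + 1) * (A - s)) * cell A B ε n j s - lam * ((p : ℚ) ^ (L * (A - s)) * cell A B 0 N J s)) *
        ((p : ℚ) ^ (L * s) * hsum s J) by ring]
  refine Valuation.map_add_le _ ?_ ?_
  · rw [map_mul]
    calc _ ≤ exp (-(m : ℤ)) * exp (-((L : ℤ) + 1)) := mul_le_mul' hx₁ hH
      _ ≤ _ := by rw [← exp_add, exp_le_exp]; omega
  · rw [map_mul]
    calc _ ≤ exp (-((L : ℤ) + m)) * 1 := mul_le_mul' hlaw (level_hsum_integral hJlt s)
      _ = _ := mul_one _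

end circzero

/-! ## The one-level reduction in the regime: error `≤ exp(−(L+B))` -/

section reduction

variable (hp2 : p ≠ 2) {A B ε N n₀ L : ℕ} (hAB : 2 * B ≤ A) (hB : 1 ≤ B) (hε : ε ≤ 1) (hn₀ : n₀ < p)
  (hN : N < p ^ (L + 1)) (h32 : 2 * p ≤ 3 * n₀) {g : ℕ → ℚ} (hg : ∀ k, k ≤ n₀ + N * p → Rat.padicValuation p (g k) ≤ 1)
include hp2 hAB hB hε hn₀ hN h32 hg

/-- **ONE-LEVEL REDUCTION IN THE REGIME `3n₀ ≥ 2p`, cells**: the reduction error of `BrickLevelReductionInf.level_reduction_inf`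
is `≤ exp(−(L+B))` (° cells: residue law with the bonus, `m ≥ B` by `carries_pos`; centre: `centre_cell_bonus`; hole
cells: `exp(−(A+L))`, `A ≥ B`). -/
theorem level_reduction_bonus (s : ℕ) :
    Rat.padicValuation p (∑ k ∈ range (n₀ + N * p + 1), g k * ((p : ℚ) ^ ((L + 1) * (A - s)) * cell A B ε (n₀ + N * p) k s) -
      ∑ K ∈ range (N + 1), blockWeight A B ε p n₀ N g K * ((p : ℚ) ^ (L * (A - s)) * cell A B 0 N K s) -
      ∑ K ∈ range N, holeWeight A B ε p n₀ (N - 1) g K * ((p : ℚ) ^ (L * (A - s)) * cell A B 0 (N - 1) K s)) ≤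
      exp (-((L : ℤ) + B)) := by
  have hp : p.Prime := Fact.out
  have hn := row_lt (L := L) hn₀ hN
  have hBA : B ≤ A := by omega
  set n := n₀ + N * p with hn_def
  rw [sum_range_digit_split (p := p) _ hn₀ N]
  have hcirc : ∑ k₀ ∈ range (n₀ + 1), ∑ K ∈ range (N + 1),
      g (k₀ + K * p) * ((p : ℚ) ^ ((L + 1) * (A - s)) * cell A B ε n (k₀ + K * p) s) -
      ∑ K ∈ range (N + 1), blockWeight A B ε p n₀ N g K * ((p : ℚ) ^ (L * (A - s)) * cell A B 0 N K s) =
      ∑ k₀ ∈ range (n₀ + 1), ∑ K ∈ range (N + 1), g (k₀ + K * p) *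
        ((p : ℚ) ^ ((L + 1) * (A - s)) * cell A B ε n (k₀ + K * p) s -
          cTop A B ε n (k₀ + K * p) / cTop A B 0 N K * ((p : ℚ) ^ (L * (A - s)) * cell A B 0 N K s)) := by
    simp only [blockWeight, ← hn_def, Finset.sum_mul, mul_sub, Finset.sum_sub_distrib]
    rw [Finset.sum_comm (s := range (N + 1)) (t := range (n₀ + 1))]
    congr 1
    exact Finset.sum_congr rfl fun k₀ _ => Finset.sum_congr rfl fun K _ => by ring
  have hhole : ∑ k₀ ∈ Ico (n₀ + 1) p, ∑ K ∈ range N,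
      g (k₀ + K * p) * ((p : ℚ) ^ ((L + 1) * (A - s)) * cell A B ε n (k₀ + K * p) s) -
      ∑ K ∈ range N, holeWeight A B ε p n₀ (N - 1) g K * ((p : ℚ) ^ (L * (A - s)) * cell A B 0 (N - 1) K s) =
      ∑ k₀ ∈ Ico (n₀ + 1) p, ∑ K ∈ range N, (g (k₀ + K * p) *
        ((p : ℚ) ^ ((L + 1) * (A - s)) * cell A B ε n (k₀ + K * p) s) - g (k₀ + K * p) *
          (cTop A B ε (n₀ + (N - 1 + 1) * p) (k₀ + K * p) / cTop A B 0 (N - 1) K) *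
          ((p : ℚ) ^ (L * (A - s)) * cell A B 0 (N - 1) K s)) := by
    simp only [holeWeight, Finset.sum_mul, Finset.sum_sub_distrib]
    rw [Finset.sum_comm (s := range N) (t := Ico (n₀ + 1) p)]
  rw [show ∀ a b c d : ℚ, a + b - c - d = (a - c) + (b - d) from fun a b c d => by ring, hcirc, hhole]
  refine Valuation.map_add_le _ (Valuation.map_sum_le _ fun k₀ hk₀ => Valuation.map_sum_le _ fun K hK => ?_)
    (Valuation.map_sum_le _ fun k₀ hk₀ => Valuation.map_sum_le _ fun K hK => ?_)
  · -- a ° cell, with the bonus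
    have hk₀' := mem_range.1 hk₀
    have hK' := mem_range.1 hK
    have hkn : k₀ + K * p ≤ n := by rw [hn_def]; nlinarith
    rw [map_mul]
    refine (mul_le_mul' (hg _ hkn) ?_).trans (by rw [one_mul])
    by_cases hc : 2 * (k₀ + K * p) ≠ n ∨ ε = 0
    · refine (residueLaw_circ_depth_bonus hp2 hAB rfl rfl hN hn₀ (by omega) (by omega) hc
        (div_mul_cancel₀ _ (cTop_zero_ne_zero (by omega) A B)) (A - s)).trans (exp_le_exp.2 ?_)
      have := carryCount_ge (p := p) (B := B) (ε := ε) (c := centreCarry p n (k₀ + K * p)) h32 (show k₀ ≤ n₀ by omega)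
      linarith
    · have hε1 : ε = 1 := by omega
      have hcen : 2 * (k₀ + K * p) = n := by by_contra h; exact hc (Or.inl h)
      subst hε1
      rw [cTop_one_centre A B hcen, zero_div, zero_mul, sub_zero]
      exact (centre_cell_bonus hp2 hAB hB hn₀ hN h32 hkn hcen s).trans (exp_le_exp.2 (by omega))
  · -- a hole cell
    have hk₀' := mem_Ico.1 hk₀
    have hK' := mem_range.1 hK
    obtain ⟨m, rfl⟩ : ∃ m, N = m + 1 := ⟨N - 1, by omega⟩
    rw [Nat.add_sub_cancel] at *
    have hm : m < p ^ (L + 1) := by omega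
    have hkn : k₀ + K * p ≤ n := by rw [hn_def]; nlinarith
    by_cases hc : 2 * (k₀ + K * p) ≠ n ∨ ε = 0
    · exact (hole_cell_le hp2 hAB hε hn₀ hm (by omega) (by omega) hk₀'.2 hc (hg _ hkn) (A - s)).trans
        (exp_le_exp.2 (by omega))
    · have hε1 : ε = 1 := by omega
      have hcen : 2 * (k₀ + K * p) = n := by by_contra h; exact hc (Or.inl h)
      subst hε1
      rw [hn_def] at hcen
      rw [cTop_one_centre A B hcen, zero_div, mul_zero, zero_mul, sub_zero, map_mul]
      have hcb := (centre_cell_bonus hp2 hAB hB hn₀ hN h32 hkn hcen s).trans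
        (exp_le_exp.2 (show -((L : ℤ) + 1 + B) ≤ -((L : ℤ) + B) by omega))
      exact (mul_le_mul' (hg _ hkn) hcb).trans (by rw [one_mul])

/-- **ONE-LEVEL REDUCTION IN THE REGIME, harmonic cell `s = 0`**. -/
theorem level_reduction_bonus_zero :
    Rat.padicValuation p (∑ k ∈ range (n₀ + N * p + 1), g k * ((p : ℚ) ^ ((L + 1) * A) * cellZero A B ε (n₀ + N * p) k) -
      ∑ K ∈ range (N + 1), blockWeight A B ε p n₀ N g K * ((p : ℚ) ^ (L * A) * cellZero A B 0 N K) -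
      ∑ K ∈ range N, holeWeight A B ε p n₀ (N - 1) g K * ((p : ℚ) ^ (L * A) * cellZero A B 0 (N - 1) K)) ≤
      exp (-((L : ℤ) + B)) := by
  have hp : p.Prime := Fact.out
  have hn := row_lt (L := L) hn₀ hN
  have hBA : B ≤ A := by omega
  set n := n₀ + N * p with hn_def
  rw [sum_range_digit_split (p := p) _ hn₀ N]
  have hcirc : ∑ k₀ ∈ range (n₀ + 1), ∑ K ∈ range (N + 1),
      g (k₀ + K * p) * ((p : ℚ) ^ ((L + 1) * A) * cellZero A B ε n (k₀ + K * p)) -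
      ∑ K ∈ range (N + 1), blockWeight A B ε p n₀ N g K * ((p : ℚ) ^ (L * A) * cellZero A B 0 N K) =
      ∑ k₀ ∈ range (n₀ + 1), ∑ K ∈ range (N + 1), g (k₀ + K * p) *
        ((p : ℚ) ^ ((L + 1) * A) * cellZero A B ε n (k₀ + K * p) -
          cTop A B ε n (k₀ + K * p) / cTop A B 0 N K * ((p : ℚ) ^ (L * A) * cellZero A B 0 N K)) := by
    simp only [blockWeight, ← hn_def, Finset.sum_mul, mul_sub, Finset.sum_sub_distrib]
    rw [Finset.sum_comm (s := range (N + 1)) (t := range (n₀ + 1))]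
    congr 1
    exact Finset.sum_congr rfl fun k₀ _ => Finset.sum_congr rfl fun K _ => by ring
  have hhole : ∑ k₀ ∈ Ico (n₀ + 1) p, ∑ K ∈ range N,
      g (k₀ + K * p) * ((p : ℚ) ^ ((L + 1) * A) * cellZero A B ε n (k₀ + K * p)) -
      ∑ K ∈ range N, holeWeight A B ε p n₀ (N - 1) g K * ((p : ℚ) ^ (L * A) * cellZero A B 0 (N - 1) K) =
      ∑ k₀ ∈ Ico (n₀ + 1) p, ∑ K ∈ range N, (g (k₀ + K * p) *
        ((p : ℚ) ^ ((L + 1) * A) * cellZero A B ε n (k₀ + K * p)) - g (k₀ + K * p) *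
          (cTop A B ε (n₀ + (N - 1 + 1) * p) (k₀ + K * p) / cTop A B 0 (N - 1) K) *
          ((p : ℚ) ^ (L * A) * cellZero A B 0 (N - 1) K)) := by
    simp only [holeWeight, Finset.sum_mul, Finset.sum_sub_distrib]
    rw [Finset.sum_comm (s := range N) (t := Ico (n₀ + 1) p)]
  rw [show ∀ a b c d : ℚ, a + b - c - d = (a - c) + (b - d) from fun a b c d => by ring, hcirc, hhole]
  refine Valuation.map_add_le _ (Valuation.map_sum_le _ fun k₀ hk₀ => Valuation.map_sum_le _ fun K hK => ?_)
    (Valuation.map_sum_le _ fun k₀ hk₀ => Valuation.map_sum_le _ fun K hK => ?_)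
  · have hk₀' := mem_range.1 hk₀
    have hK' := mem_range.1 hK
    have hkn : k₀ + K * p ≤ n := by rw [hn_def]; nlinarith
    rw [map_mul]
    refine (mul_le_mul' (hg _ hkn) ?_).trans (by rw [one_mul])
    by_cases hc : 2 * (k₀ + K * p) ≠ n ∨ ε = 0
    · refine (residueLaw_circ_zero_bonus hp2 hAB rfl rfl hN hn₀ (by omega) (by omega) hc
        (div_mul_cancel₀ _ (cTop_zero_ne_zero (by omega) A B))).trans (exp_le_exp.2 ?_)
      have := carryCount_ge (p := p) (B := B) (ε := ε) (c := centreCarry p n (k₀ + K * p)) h32 (show k₀ ≤ n₀ by omega)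
      linarith
    · have hε1 : ε = 1 := by omega
      have hcen : 2 * (k₀ + K * p) = n := by by_contra h; exact hc (Or.inl h)
      subst hε1
      rw [cTop_one_centre A B hcen, zero_div, zero_mul, sub_zero]
      exact (centre_cellZero_bonus hp2 hAB hB hn₀ hN h32 hkn hcen).trans (exp_le_exp.2 (by omega))
  · have hk₀' := mem_Ico.1 hk₀
    have hK' := mem_range.1 hK
    obtain ⟨m, rfl⟩ : ∃ m, N = m + 1 := ⟨N - 1, by omega⟩
    rw [Nat.add_sub_cancel] at *
    have hm : m < p ^ (L + 1) := by omega
    have hkn : k₀ + K * p ≤ n := by rw [hn_def]; nlinarith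
    by_cases hc : 2 * (k₀ + K * p) ≠ n ∨ ε = 0
    · exact (hole_cellZero_le hp2 hAB hε hn₀ hm (by omega) (by omega) hk₀'.2 hc (hg _ hkn)).trans
        (exp_le_exp.2 (by omega))
    · have hε1 : ε = 1 := by omega
      have hcen : 2 * (k₀ + K * p) = n := by by_contra h; exact hc (Or.inl h)
      subst hε1
      rw [hn_def] at hcen
      rw [cTop_one_centre A B hcen, zero_div, mul_zero, zero_mul, sub_zero, map_mul]
      have hcb := (centre_cellZero_bonus hp2 hAB hB hn₀ hN h32 hkn hcen).trans
        (exp_le_exp.2 (show -((L : ℤ) + 1 + B) ≤ -((L : ℤ) + B) by omega))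
      exact (mul_le_mul' (hg _ hkn) hcb).trans (by rw [one_mul])

end reduction

end

end Summit.KontsevichZagierPeriods.Zeta5Search.BrickBonusReduction
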